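import Mathlib
import HarnessLib
import Literature.Probability.MarkovChains.MetropolisHastings
import Summits.Ventures.LatticeQCDFlow.Exactness.JarzynskiFinite

/-!
# Local (masked) updates are exact: frozen-block kernels keep the Gibbs weight stationary

HONEST FRAMING: exact (Metropolis-corrected) sampling algorithms for lattice gauge theory;
figures of merit are autocorrelation/cost numbers at stated couplings and volumes; no
continuum-physics claim.

Venture `LatticeQCDFlow` (cell pub-lqcd), topic `Exactness`; FANOUT row 19 (`su2-snf`, family C:
defect / OBC→PBC non-equilibrium MCMC).  NEW WORK of the cell (elementary finite sums), not a
published result; the only printed names (heat-bath / Gibbs updates of a block with the rest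
frozen; Jarzynski's equality) appear in docstrings, nothing is cited as a fact.

## Content

The configuration space is a product `X × Y`: `X` = the degrees of freedom a LOCAL update touches
(the links inside a neighbourhood of the defect, lever `protocol.sweep_region = defect-ball` of
HOME/su2-snf/CARD-su2-snf.md §4 L2), `Y` = the frozen complement.  A masked sweep is a kernel
that, at frozen `y`, moves `x` by a row kernel `T y` on `X` and never changes `y`:
`blockKernel T (x, y) (x', y') = if y' = y then T y x x' else 0`.

* `blockKernel_detailedBalance` — if every `T y` is in detailed balance with the CONDITIONAL
  weight `x ↦ π (x, y)` then `blockKernel T` is in detailed balance with `π` on `X × Y`;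
* `blockKernel_isStationary` — the same with stationarity (all a Jarzynski step needs);
* `blockKernel_sum_eq_one` — row sums are inherited;
* `isStationary_comp` — composing two `π`-stationary kernels is `π`-stationary (a masked sweep
  followed by any other exact update, or several masks in turn);
* `jarzynski_blockUpdates` — hence the finite-state Jarzynski identity
  (`Exactness.jarzynski`, row 30) holds VERBATIM for protocols whose per-step kernels are masked
  sweeps: restricting the non-equilibrium relaxation to a neighbourhood of the defect changes the
  dissipated work / ESS, never the exactness of the reweighted estimator.

Dictionary: `π (x, y) = e^{-S_λ (x, y)}` at the current protocol parameter; `T y` = a heat-bath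
(+ over-relaxation) sweep of the masked links with the complement `y` held fixed — a heat-bath
update samples the exact conditional and an over-relaxation reflection is an involutive
measure-preserving map, so each is in detailed balance with `x ↦ e^{-S_λ (x, y)}`; irreducibility
of the overall sampler is supplied by the full prior-chain sweeps, not by the masked ones, and is
not needed for the identity.
-/

namespace Summit.Ventures.LatticeQCDFlow.Exactness

open Finset
open Literature.Probability.MarkovChains

variable {X Y : Type*} [Fintype X] [Fintype Y] [DecidableEq Y]

/-! ## Frozen-block kernels -/

/-- The kernel on `X × Y` that updates the `X`-block with the row kernel `T y` at frozen
complement `y` and never moves `y` (a masked / local sweep). -/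
def blockKernel (T : Y → X → X → ℝ) (a b : X × Y) : ℝ :=
  if b.2 = a.2 then T a.2 a.1 b.1 else 0

omit [Fintype X] [Fintype Y] in
/-- Same complement: the block kernel is the conditional kernel. -/
theorem blockKernel_same (T : Y → X → X → ℝ) (x x' : X) (y : Y) :
    blockKernel T (x, y) (x', y) = T y x x' := by
  simp [blockKernel]

omit [Fintype X] [Fintype Y] in
/-- Different complements are never connected. -/
theorem blockKernel_of_ne (T : Y → X → X → ℝ) {a b : X × Y} (h : b.2 ≠ a.2) :
    blockKernel T a b = 0 := by
  simp [blockKernel, h]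

omit [Fintype X] [Fintype Y] in
/-- **Detailed balance is inherited from the conditionals.**  If each `T y` is reversible for the
conditional weight `x ↦ π (x, y)`, the frozen-block kernel is reversible for `π`. -/
theorem blockKernel_detailedBalance {π : X × Y → ℝ} {T : Y → X → X → ℝ}
    (h : ∀ y, DetailedBalance (fun x => π (x, y)) (T y)) :
    DetailedBalance π (blockKernel T) := by
  rintro ⟨x, y⟩ ⟨x', y'⟩
  by_cases hy : y' = y
  · subst hy
    simpa [blockKernel] using h y' x x'
  · have hy' : ¬ (y = y') := fun e => hy e.symm
    simp [blockKernel, hy, hy']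

/-- **Stationarity is inherited from the conditionals** (the hypothesis a non-equilibrium protocol
step needs, `Exactness.jarzynski`).  If each `T y` leaves `x ↦ π (x, y)` stationary, the
frozen-block kernel leaves `π` stationary. -/
theorem blockKernel_isStationary {π : X × Y → ℝ} {T : Y → X → X → ℝ}
    (h : ∀ y, IsStationary (fun x => π (x, y)) (T y)) :
    IsStationary π (blockKernel T) := by
  rintro ⟨x', y'⟩
  rw [Fintype.sum_prod_type, Finset.sum_comm, Finset.sum_eq_single y']
  · simpa [blockKernel] using h y' x'
  · intro y _ hy
    have hy' : y' ≠ y := fun e => hy e.symm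
    simp [blockKernel, hy']
  · intro hy
    exact absurd (Finset.mem_univ y') hy

/-- Row sums are inherited: if every conditional kernel is stochastic, so is the block kernel. -/
theorem blockKernel_sum_eq_one {T : Y → X → X → ℝ} (h : ∀ y x, ∑ x', T y x x' = 1)
    (a : X × Y) : ∑ b, blockKernel T a b = 1 := by
  rw [Fintype.sum_prod_type, Finset.sum_comm, Finset.sum_eq_single a.2]
  · simpa [blockKernel] using h a.2 a.1
  · intro y _ hy
    simp [blockKernel, hy]
  · intro hy
    exact absurd (Finset.mem_univ a.2) hy

omit [Fintype X] [Fintype Y] in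
/-- Non-negativity is inherited. -/
theorem blockKernel_nonneg {T : Y → X → X → ℝ} (h : ∀ y x x', 0 ≤ T y x x') (a b : X × Y) :
    0 ≤ blockKernel T a b := by
  unfold blockKernel
  split_ifs
  · exact h _ _ _
  · exact le_rfl

/-! ## Composition of exact updates -/

/-- Composition of two row kernels (first `P`, then `Q`). -/
noncomputable def compKernel {Z : Type*} [Fintype Z] (P Q : Z → Z → ℝ) (a c : Z) : ℝ :=
  ∑ b, P a b * Q b c

/-- **Composing stationary kernels is stationary**: a masked sweep followed by any other exact
update (another mask, a full sweep) still leaves `π` invariant. -/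
theorem isStationary_comp {Z : Type*} [Fintype Z] {π : Z → ℝ} {P Q : Z → Z → ℝ}
    (hP : IsStationary π P) (hQ : IsStationary π Q) : IsStationary π (compKernel P Q) := by
  intro c
  unfold compKernel
  calc ∑ a, π a * ∑ b, P a b * Q b c
      = ∑ a, ∑ b, π a * P a b * Q b c := by simp_rw [Finset.mul_sum, ← mul_assoc]
    _ = ∑ b, ∑ a, π a * P a b * Q b c := Finset.sum_comm
    _ = ∑ b, (∑ a, π a * P a b) * Q b c := by simp_rw [← Finset.sum_mul]
    _ = ∑ b, π b * Q b c := Finset.sum_congr rfl fun b _ => by rw [hP b]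
    _ = π c := hQ c

/-- Row sums of a composition of stochastic kernels. -/
theorem compKernel_sum_eq_one {Z : Type*} [Fintype Z] {P Q : Z → Z → ℝ}
    (hP : ∀ a, ∑ b, P a b = 1) (hQ : ∀ b, ∑ c, Q b c = 1) (a : Z) :
    ∑ c, compKernel P Q a c = 1 := by
  unfold compKernel
  rw [Finset.sum_comm]
  simp_rw [← Finset.mul_sum, hQ, mul_one, hP]

/-! ## Jarzynski with local protocol sweeps -/

/-- **Jarzynski's equality with masked protocol sweeps.**  For a protocol `S 0, …, S n` on the
product configuration space `X × Y` whose `k`-th relaxation step is the frozen-block kernel of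
conditional kernels `T k y`, each leaving `x ↦ e^{-S (k+1) (x, y)}` stationary, the path average
of `e^{-W}` started in equilibrium at `S 0` equals `Z n / Z 0` exactly — `Exactness.jarzynski`
(row 30) applied verbatim: the lever `protocol.sweep_region = defect-ball` of CARD-su2-snf §4 L2
is EXACT; only the dissipated work (hence the ESS) depends on the mask. -/
theorem jarzynski_blockUpdates {n : ℕ} (S : Fin (n + 1) → X × Y → ℝ)
    (T : Fin n → Y → X → X → ℝ)
    (hT : ∀ k : Fin n, ∀ y, IsStationary (fun x => Real.exp (-S k.succ (x, y))) (T k y)) :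
    ∑ p : Fin (n + 1) → X × Y, pathLaw (gibbsLaw (S 0)) (fun k => blockKernel (T k)) p *
        Real.exp (-work S p) = partitionFn (S (Fin.last n)) / partitionFn (S 0) :=
  jarzynski S (fun k => blockKernel (T k)) fun k => blockKernel_isStationary (hT k)

end Summit.Ventures.LatticeQCDFlow.Exactness
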